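import Summits.QuantumFields.BalabanUV.Gaps.D4WalkBlockGlue
import Summits.QuantumFields.BalabanUV.T4Continuum.Spine.NE5.TwoRunPencilBlocks

/-!
# Spine/NE5/TwoRunPencilBlockGlue — row NE5's two-run pencil at the LOCAL-DATA level through [B9]'s (3.87)–(3.90) gluing,
# BLOCK currency (print's cube-to-cube operator norms; NO fibre letter in the margin) — the block twin of
# `Spine/NE5/TwoRunPencilGlue` (cell `pub-balaban-gaps`, seat `ne5` gen 6)

WHY (`HOME/ne/NE5.md` §7 (r4″) ∕ (x6), standing offer (s6-b)).  `TwoRunPencilGlue` (p357313 ✓) records that NE5's pencil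
drawn between the two runs' LOCAL DATA (seed ∕ step families of [B9] (3.87)) passes through the gluing with ONE `t`-free,
`r`-free package — in the ENTRYWISE currency, whose Neumann margin carries the fibre letter `m` (the located limit V47 of
row (D4)).  g1-p2's block currency removes `m` (`Gaps/D4WalkBlockGlue.blockWalkExpansion_glue`: margin
`q = c₁·(c₁·1·(1·K̄_R)·c′)·c′`, print's «N′θc₁(α) < 1 for M sufficiently large», [B9] Thm 3.7).  THIS FILE is the
composition in that currency: `TwoRunPencilBlocks.blockWalkExpansion_pencil_reach` (×2) → `blockWalkExpansion_glue`:
* `blockWalkExpansion_glue_pencil` — seed families `S_A, S_B` and step families `R_A, R_B` of the two runs on shared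
  skeletons, each a `BlockWalkExpansion`, TERMWISE close at the local two-run rate `r` in block-walk-weighted currency
  ⟹ for every `‖t‖ ≤ s∕r` the glued kernel `S_t·(1 − R_t)⁻¹` is a `BlockWalkExpansion` (∃-packaged, distances ≥ d₁) with
  constant `c₁·(1 + s)K̄_S·(1·(1 − q_s)⁻¹)·c′`, `q_s = c₁(c₁·1·(1·(1 + s)K̄_R)c′)c′` — no `t`, no `r`, NO `m`;
* `blockWalkExpansion_glue_pencilParam` — over `E × ℂ`: joint analyticity in (background, `t`) of the glued kernel's
  block expansion (`.toJoint.analyticOnBall`).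
So in the currency NODE O now builds in, NE5's two-run input for the Γ-slot of a (2.14)-term is again needed ONLY for
the LOCAL seed ∕ step factors (row NE2 ∕ NE3), and the pencil's own Neumann margin is NE5's free reach `s` (x6).
HONEST FRAMING.  A two-line composition of LANDED theorems over hypothesis SHAPES; nothing of Bałaban's is constructed
or asserted; NE5 NOT PRINTED ∕ NOT PROVED; (D4) 0∕1; 0∕12 NE5 leaves; words UNCHANGED.  Rung (B)+1 on a FIXED finite T⁴ —
NOT continuum, NOT infinite volume, NOT mass gap, NOT Clay.  Spine PROVED 0∕9.  0 sorry, 0 `def`.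
Sources: [B9] = T. Bałaban, CMP **99** (1985) [Balaban1985BackgroundPropagators] (3.87)–(3.90) p. 409, Thm 3.7, Thm 3.10
p. 416, p. 422; [II] = CMP **116** (1988) [Balaban1988RG2Cluster] (1.5) p. 3, p. 13, p. 15.  Nothing here is a claim about the mass gap.
-/

noncomputable section

namespace Summit.QuantumFields.BalabanUV.T4Continuum.Spine.NE5.TwoRunPencilBlockGlue

open Metric Set
open Literature.MathematicalPhysics.QuantumFieldTheory.Balaban1983to89
open Literature.MathematicalPhysics.QuantumFieldTheory.Balaban1983to89.B9SectDWalk (DomBy)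
open Literature.MathematicalPhysics.QuantumFieldTheory.Balaban1983to89.B9Thm34Ext (toB6)
open Literature.MathematicalPhysics.QuantumFieldTheory.Balaban1983to89.B9Thm37GlueTorus (torusGeom)
open Literature.MathematicalPhysics.QuantumFieldTheory.Balaban1983to89.TreeLengthTorus (TPt)
open Literature.MathematicalPhysics.QuantumFieldTheory.Balaban1983to89.B5TorusCover (UT)
open Literature.MathematicalPhysics.QuantumFieldTheory.Balaban1983to89.B11SectG (RowSum)
open Summit.QuantumFields.BalabanUV.Gaps.D4WalkBlock (blockNorm BlockWalkExpansion)
open Summit.QuantumFields.BalabanUV.Gaps.D4WalkBlockGlue (blockWalkExpansion_glue)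
open Summit.QuantumFields.BalabanUV.T4Continuum.Spine.NE5.TwoRunPencilBlocks
  (blockWalkExpansion_pencil_reach blockWalkExpansion_pencilParam)

variable {ν : ℕ} {K : Fin ν → ℕ} [∀ i, NeZero (K i)]
variable {d N' : ℕ} {p n : Type} [Fintype p] [Fintype n] [DecidableEq n]
variable {E : Type*} [NormedAddCommGroup E] [NormedSpace ℂ E]
variable {c₀ : B13.Consts} {cub : p → UT K} {cubn : n → UT K} {X : Finset (UT K)}
variable {SA SB : (TPt d N' → ℂ) → E → Matrix p n ℂ} {RA RB : (TPt d N' → ℂ) → E → Matrix n n ℂ}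
variable {WS WR : Type} {TSA TSB : WS → (TPt d N' → ℂ) → E → Matrix p n ℂ} {TRA TRB : WR → (TPt d N' → ℂ) → E → Matrix n n ℂ}
variable {SXS : Set WS} {SXR : Set WR} {AS ASB : WS → ℝ} {AR ARB : WR → ℝ}
variable {DS : WS → UT K → UT K → ℝ} {DR : WR → UT K → UT K → ℝ}
variable {R ρS εS κS KbarS RSB ρSB εSB κSB KbarSB ρR εR κR KbarR RRB ρRB εRB κRB KbarRB : ℝ}
variable {ρ ε ρs σ₁ c₁ σ' c' κs κ ρ' ε' κ' : ℝ}

/-- **THE GLUED KERNEL ALONG NE5's LOCAL-DATA PENCIL, BLOCK CURRENCY** — `t`-free, `r`-free, fibre-free package.  Data as in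
`TwoRunPencilGlue.jointWalkExpansion_glue_pencil` with `BlockWalkExpansion`s over cube maps and block-walk-weighted termwise
closeness; the windows of `D4WalkBlockGlue.blockWalkExpansion_glue` with run A's constants inflated by the reach,
`K̄ ↦ (1 + s)K̄`. [cite: Balaban1985BackgroundPropagators, (3.87)–(3.90) p.409, Thm 3.10 p.416, p.422; Balaban1988RG2Cluster, (1.5) p.3, p.13, p.15] -/
theorem blockWalkExpansion_glue_pencil
    (hSA : BlockWalkExpansion c₀ cub cubn SA X R εS κS KbarS TSA SXS AS DS ρS)
    (hSB : BlockWalkExpansion c₀ cub cubn SB X RSB εSB κSB KbarSB TSB SXS ASB DS ρSB) (hRSB : R ≤ RSB)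
    (hRA : BlockWalkExpansion c₀ cubn cubn RA X R εR κR KbarR TRA SXR AR DR ρR)
    (hRB : BlockWalkExpansion c₀ cubn cubn RB X RRB εRB κRB KbarRB TRB SXR ARB DR ρRB) (hRRB : R ≤ RRB)
    (hSdom : ∀ ω, DomBy (toB6 (torusGeom K 0 0 0) 0 True) (DS ω))
    (hRdom : ∀ ω, DomBy (toB6 (torusGeom K 0 0 0) 0 True) (DR ω))
    {r s : ℝ} (hr : 0 < r) (hs : 0 ≤ s)
    (hdiffS : ∀ ω, ∀ σ₀ : TPt d N' → ℂ, (∀ j, ‖σ₀ j‖ ≤ Real.exp c₀.κ₁) → ∀ u ∈ ball (0 : E) R,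
      ∀ y y', blockNorm cub cubn (TSB ω σ₀ u - TSA ω σ₀ u) y y' ≤ r * (AS ω * Real.exp (-(ρS * DS ω y y'))))
    (hdiffR : ∀ ω, ∀ σ₀ : TPt d N' → ℂ, (∀ j, ‖σ₀ j‖ ≤ Real.exp c₀.κ₁) → ∀ u ∈ ball (0 : E) R,
      ∀ y y', blockNorm cubn cubn (TRB ω σ₀ u - TRA ω σ₀ u) y y' ≤ r * (AR ω * Real.exp (-(ρR * DR ω y y'))))
    (hrow : RowSum (toB6 (torusGeom K 0 0 0) 0 True) σ₁ c₁) (hrow' : RowSum (toB6 (torusGeom K 0 0 0) 0 True) σ' c')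
    (hσ₁ : 0 ≤ σ₁) (hσ' : 0 ≤ σ') (hc₁ : 0 ≤ c₁) (hc' : 0 ≤ c')
    (hε : 0 ≤ ε) (hερ : ε ≤ ρ) (hρs : ρ + σ₁ ≤ ρs) (hρsR : ρs ≤ ρR) (hwR : ρR - εR ≤ ρ - ε)
    (hKR : 0 ≤ KbarR) (hκs : 0 ≤ κs) (hκsR : κs ≤ κR) (hκsC : κs + σ' ≤ ρ - ε) (hκ : 0 ≤ κ) (hκC : κ ≤ ρ - ε)
    (hκκs : κ + σ' ≤ κs)
    (hq : c₁ * (c₁ * 1 * (1 * ((1 + s) * KbarR)) * c') * c' < 1)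
    (hρ' : 0 ≤ ρ') (hρ'ρ : ρ' ≤ ρ) (hρ'S : ρ' + σ₁ ≤ ρS) (hε' : 0 ≤ ε') (hwS : ρS - εS ≤ ρ' - ε') (hw1 : ρ - ε ≤ ρ' - ε')
    (hKS : 0 ≤ KbarS) (hκ' : 0 ≤ κ') (hκ'κ : κ' ≤ κ) (hκ'S : κ' + σ' ≤ κS)
    {t : ℂ} (ht : ‖t‖ ≤ s / r) :
    ∃ (W : Type) (T : W → (TPt d N' → ℂ) → E → Matrix p n ℂ) (SX : Set W) (A : W → ℝ) (D : W → UT K → UT K → ℝ)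
      (ρ₀ : ℝ), BlockWalkExpansion c₀ cub cubn
        (fun σ₀ u => (SA σ₀ u + t • (SB σ₀ u - SA σ₀ u)) *
          ((1 : Matrix n n ℂ) + (-1 : ℂ) • (RA σ₀ u + t • (RB σ₀ u - RA σ₀ u)))⁻¹) X R ε' κ'
        (c₁ * ((1 + s) * KbarS) * (1 * (1 - c₁ * (c₁ * 1 * (1 * ((1 + s) * KbarR)) * c') * c')⁻¹) * c') T SX A D ρ₀ ∧
      ∀ ω, DomBy (toB6 (torusGeom K 0 0 0) 0 True) (D ω) :=
  have hs1 : 0 ≤ 1 + s := by positivity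
  blockWalkExpansion_glue (blockWalkExpansion_pencil_reach hSA hSB hRSB hr hs hdiffS ht)
    (blockWalkExpansion_pencil_reach hRA hRB hRRB hr hs hdiffR ht) hSdom hRdom hrow hrow' hσ₁ hσ' hc₁ hc' hε hερ hρs
    hρsR hwR (mul_nonneg hs1 hKR) hκs hκsR hκsC hκ hκC hκκs hq hρ' hρ'ρ hρ'S hε' hwS hw1 (mul_nonneg hs1 hKS) hκ' hκ'κ hκ'S

/-- **THE GLUED KERNEL OVER `E × ℂ`, BLOCK CURRENCY** (row (D4)'s seam ball × row NE5's pencil at once): joint analyticity in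
(background, interpolation parameter) of the glued kernel's block walk expansion, constant
`c₁·(1 + τr)K̄_S·(1·(1 − q)⁻¹)·c′`, `q = c₁(c₁·1·(1·(1 + τr)K̄_R)c′)c′`. [cite: Balaban1985BackgroundPropagators, (3.87)–(3.90) p.409, Thm 3.10 p.416; Balaban1988RG2Cluster, (1.5) p.3, p.15] -/
theorem blockWalkExpansion_glue_pencilParam
    (hSA : BlockWalkExpansion c₀ cub cubn SA X R εS κS KbarS TSA SXS AS DS ρS)
    (hSB : BlockWalkExpansion c₀ cub cubn SB X RSB εSB κSB KbarSB TSB SXS ASB DS ρSB) (hRSB : R ≤ RSB)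
    (hRA : BlockWalkExpansion c₀ cubn cubn RA X R εR κR KbarR TRA SXR AR DR ρR)
    (hRB : BlockWalkExpansion c₀ cubn cubn RB X RRB εRB κRB KbarRB TRB SXR ARB DR ρRB) (hRRB : R ≤ RRB)
    (hSdom : ∀ ω, DomBy (toB6 (torusGeom K 0 0 0) 0 True) (DS ω))
    (hRdom : ∀ ω, DomBy (toB6 (torusGeom K 0 0 0) 0 True) (DR ω))
    {r τ : ℝ} (hr : 0 ≤ r) (hτ : 0 ≤ τ)
    (hdiffS : ∀ ω, ∀ σ₀ : TPt d N' → ℂ, (∀ j, ‖σ₀ j‖ ≤ Real.exp c₀.κ₁) → ∀ u ∈ ball (0 : E) R,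
      ∀ y y', blockNorm cub cubn (TSB ω σ₀ u - TSA ω σ₀ u) y y' ≤ r * (AS ω * Real.exp (-(ρS * DS ω y y'))))
    (hdiffR : ∀ ω, ∀ σ₀ : TPt d N' → ℂ, (∀ j, ‖σ₀ j‖ ≤ Real.exp c₀.κ₁) → ∀ u ∈ ball (0 : E) R,
      ∀ y y', blockNorm cubn cubn (TRB ω σ₀ u - TRA ω σ₀ u) y y' ≤ r * (AR ω * Real.exp (-(ρR * DR ω y y'))))
    (hrow : RowSum (toB6 (torusGeom K 0 0 0) 0 True) σ₁ c₁) (hrow' : RowSum (toB6 (torusGeom K 0 0 0) 0 True) σ' c')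
    (hσ₁ : 0 ≤ σ₁) (hσ' : 0 ≤ σ') (hc₁ : 0 ≤ c₁) (hc' : 0 ≤ c')
    (hε : 0 ≤ ε) (hερ : ε ≤ ρ) (hρs : ρ + σ₁ ≤ ρs) (hρsR : ρs ≤ ρR) (hwR : ρR - εR ≤ ρ - ε)
    (hKR : 0 ≤ KbarR) (hκs : 0 ≤ κs) (hκsR : κs ≤ κR) (hκsC : κs + σ' ≤ ρ - ε) (hκ : 0 ≤ κ) (hκC : κ ≤ ρ - ε)
    (hκκs : κ + σ' ≤ κs)
    (hq : c₁ * (c₁ * 1 * (1 * ((1 + τ * r) * KbarR)) * c') * c' < 1)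
    (hρ' : 0 ≤ ρ') (hρ'ρ : ρ' ≤ ρ) (hρ'S : ρ' + σ₁ ≤ ρS) (hε' : 0 ≤ ε') (hwS : ρS - εS ≤ ρ' - ε') (hw1 : ρ - ε ≤ ρ' - ε')
    (hKS : 0 ≤ KbarS) (hκ' : 0 ≤ κ') (hκ'κ : κ' ≤ κ) (hκ'S : κ' + σ' ≤ κS) :
    ∃ (W : Type) (T : W → (TPt d N' → ℂ) → E × ℂ → Matrix p n ℂ) (SX : Set W) (A : W → ℝ) (D : W → UT K → UT K → ℝ)
      (ρ₀ : ℝ), BlockWalkExpansion c₀ cub cubn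
        (fun σ₀ (v : E × ℂ) => (SA σ₀ v.1 + (((τ / R : ℝ) : ℂ) * v.2) • (SB σ₀ v.1 - SA σ₀ v.1)) *
          ((1 : Matrix n n ℂ) + (-1 : ℂ) • (RA σ₀ v.1 + (((τ / R : ℝ) : ℂ) * v.2) • (RB σ₀ v.1 - RA σ₀ v.1)))⁻¹) X R ε' κ'
        (c₁ * ((1 + τ * r) * KbarS) * (1 * (1 - c₁ * (c₁ * 1 * (1 * ((1 + τ * r) * KbarR)) * c') * c')⁻¹) * c')
        T SX A D ρ₀ ∧
      ∀ ω, DomBy (toB6 (torusGeom K 0 0 0) 0 True) (D ω) :=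
  have h1 : 0 ≤ 1 + τ * r := by positivity
  blockWalkExpansion_glue (blockWalkExpansion_pencilParam hSA hSB hRSB hr hτ hdiffS)
    (blockWalkExpansion_pencilParam hRA hRB hRRB hr hτ hdiffR) hSdom hRdom hrow hrow' hσ₁ hσ' hc₁ hc' hε hερ hρs
    hρsR hwR (mul_nonneg h1 hKR) hκs hκsR hκsC hκ hκC hκκs hq hρ' hρ'ρ hρ'S hε' hwS hw1 (mul_nonneg h1 hKS) hκ' hκ'κ hκ'S

end Summit.QuantumFields.BalabanUV.T4Continuum.Spine.NE5.TwoRunPencilBlockGlue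

end
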